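import Mathlib
import Summits.Ventures.HodgeRepro2.T5RamifiedParity
import Summits.Ventures.HodgeRepro2.T5DiscriminantParity
import Summits.Ventures.HodgeRepro2.T5DifferentValuation

/-! # T5ConductorParityAssembly — (A13) «d_v is EVEN at every ramified v» assembled in the kernel

Blind cell pub-hodge-repro2, seat p4 (Tier-5 kernel annex, README §7; record-class, cited by p-id
or ignored, never an input). README §8(d): uses an L-value-free non-vanishing device: NO.

The (A13) step of route/T5-route-2.md §N5.13.2 ((iii-ramified)′): «`d_v = d(E_v/F_v) + 2n_F +
v_E(δ)`; writing `E_v = F_v(√D)`, every anti-invariant `δ` lies in `F_v^× √D`, so `v_E(δ) ≡ v_E(√D)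
(mod 2)`, and `d(E_v/F_v) = v_F(4D) − 2i ≡ v_F(D) = v_E(√D) (mod 2)` … Hence `d_v` is EVEN».

This file composes the kernel witnesses of the chain into ONE theorem, `even_conductor_of_different`,
whose hypotheses are exactly the residual prose (the local-field dictionary) and the printed
conductor formula:
* the parity bookkeeping of `T5RamifiedParity.even_conductor` (p393398);
* «`d(E_v/F_v) ≡ v_F(D) (mod 2)`» from `T5DiscriminantParity.different_exponent_modEq` (p393923)
  once `d(E_v/F_v) = v_F(disc O_{E_v})`;
* «`v_F(disc O_{E_v}) = f · d(E_v/F_v)`» from `T5DifferentValuation.val_discr_eq_val_pow`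
  (p394153 + its sequel), with `f = 1`.

Hypotheses that stay prose (taken as explicit hypotheses here): the AKLB instantiation
`A = O_{F_v} ⊆ F = F_v`, `B = O_{E_v} ⊆ E = E_v` (Mathlib's `IsIntegralClosure`, Dedekind, free
of rank two with basis `b`, `Frac A` perfect), `𝔇 = P^d = (x)` with `P` the maximal ideal over
`p = (ϖ)`, residue degree `f = 1`, `v_F(ϖ) = exp(−1)`, `v_F ≤ 1` on `O_{F_v}`; the dictionary
«`v_E = 2 v_F` on `F_v`» at the two places it is used (`v_E(c) = exp(−2k)`, `v_E(D) = exp(−2 v_F(D))`);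
the shape `δ = c · √D` of an anti-invariant element (`T5QuadraticInvolution`, p392692); and the
conductor formula `d_v = 2 n_F + v_E(δ) + d` ([FM21] Lemma 3.1, [C]) — the conclusion is stated
for that expression.
-/

namespace Summit.Ventures.HodgeRepro2.T5ConductorParityAssembly

open Summit.Ventures.HodgeRepro2
open scoped WithZero nonZeroDivisors

variable (A F E B : Type*) [CommRing A] [Field F] [CommRing B] [Field E]
  [Algebra A F] [Algebra B E] [Algebra A B] [Algebra F E] [Algebra A E]
  [IsScalarTower A F E] [IsScalarTower A B E]
  [IsDedekindDomain A] [IsFractionRing A F] [FiniteDimensional F E] [Algebra.IsSeparable F E]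
  [IsIntegralClosure B A E] [IsDedekindDomain B] [Module.IsTorsionFree A B] [IsFractionRing B E]
  [IsLocalization (Algebra.algebraMapSubmonoid B A⁰) E] [PerfectField (FractionRing A)]

include F E in
/-- `d(E_v/F_v) = v_F(disc O_{E_v})` in the `ord = −log` convention: with `𝔇 = P^d = (x)`,
`P` over `p = (ϖ)`, residue degree `1`, `v_F(ϖ) = exp(−1)`:
`(d : ℤ) = -log (v_F (discr A b))`. -/
theorem different_exponent_eq_neg_log_val_discr {ι : Type*} [Fintype ι] [DecidableEq ι]
    (b : Module.Basis ι A B) (vF : Valuation A ℤᵐ⁰) (hvF : ∀ a : A, vF a ≤ 1) (ϖ : A)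
    (hϖ : vF ϖ = WithZero.exp (-1)) (P : Ideal B) [P.LiesOver (Ideal.span {ϖ})] [P.IsMaximal]
    [(Ideal.span {ϖ}).IsMaximal] (hf : P.inertiaDeg A = 1) (d : ℕ)
    (hD : differentIdeal A B = P ^ d) (x : B) (hx : differentIdeal A B = Ideal.span {x})
    (hx0 : x ≠ 0) :
    (d : ℤ) = -WithZero.log (vF (Algebra.discr A ⇑b)) := by
  have h := T5DifferentValuation.val_discr_eq_val_pow A F E B b vF hvF P ϖ d hD x hx hx0
  rw [hf, one_mul, hϖ, ← WithZero.exp_nsmul] at h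
  rw [h, WithZero.log_exp, nsmul_eq_mul, mul_neg_one, neg_neg]

/-- **(A13) assembled**: under the hypotheses listed in the module docstring,
`2 n + ord v_E δ + d` is EVEN — «`d_v` is even at every ramified `v`». -/
theorem even_conductor_of_different (b : Module.Basis (Fin 2) A B) (vF : Valuation A ℤᵐ⁰)
    (hvF : ∀ a : A, vF a ≤ 1) (ϖ : A) (hϖ : vF ϖ = WithZero.exp (-1)) (P : Ideal B)
    [P.LiesOver (Ideal.span {ϖ})] [P.IsMaximal] [(Ideal.span {ϖ}).IsMaximal]
    (hf : P.inertiaDeg A = 1) (d : ℕ) (hD : differentIdeal A B = P ^ d) (x : B)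
    (hx : differentIdeal A B = Ideal.span {x}) (hx0 : x ≠ 0)
    (s : B) (D : A) (hs : s * s = algebraMap A B D) (hns : s ∉ Set.range (algebraMap A B))
    (hD0 : vF D ≠ 0) (h2 : vF 2 ≠ 0)
    (vE : Valuation E ℤᵐ⁰) (δ : E) (c : F) (hc : c ≠ 0)
    (hδ : δ = algebraMap F E c * algebraMap B E s) (k : ℤ)
    (hck : vE (algebraMap F E c) = WithZero.exp (-(2 * k)))
    (hDE : vE (algebraMap F E (algebraMap A F D)) =
      WithZero.exp (-(2 * (-WithZero.log (vF D)))))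
    (n : ℤ) :
    Even (2 * n + T5RamifiedParity.ord vE δ + (d : ℤ)) := by
  -- `d = -log v_F(disc b)` (the different exponent is the discriminant exponent, f = 1)
  have hd := different_exponent_eq_neg_log_val_discr A F E B b vF hvF ϖ hϖ P hf d hD x hx hx0
  -- `d ≡ -log v_F(D) (mod 2)` (the discriminant-parity step)
  have hmod := T5DiscriminantParity.different_exponent_modEq vF b s D hs hns hD0 h2 (d : ℤ) hd
  have heven : Even ((d : ℤ) - -WithZero.log (vF D)) := by
    have h := (Int.modEq_iff_dvd.1 hmod)
    rw [← even_iff_two_dvd] at h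
    simpa only [neg_sub] using h.neg
  -- `√D` squared in `E`
  have hsE : (algebraMap B E s) ^ 2 = algebraMap F E (algebraMap A F D) := by
    rw [pow_two, ← map_mul, hs, ← IsScalarTower.algebraMap_apply, IsScalarTower.algebraMap_apply A F E]
  exact T5RamifiedParity.even_conductor vE hc hδ hck hsE hDE heven

end Summit.Ventures.HodgeRepro2.T5ConductorParityAssembly
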